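import Summits.HodgeConjecture.HodgeConjecture.Theorems.SixfoldTableXCensusWeilRow11KWeilAllMembersHC
import Literature.AlgebraicGeometry.HodgeTheory.CMFieldMixedPlaces
import HarnessLib

/-!
# TABLE X ROW 11 `g6.IV(2,1).kE0`, EVERY MEMBER — the census with the member datum «both places mixed» DISCHARGED
# (cell `pub-hodgeav-hg6`, req-37 (A) Q2b; eng-4 g8, lead g3 2026-08-29T06:26:43Z (a): «binder hmixed discharged»)

HONEST FRAMING. HC, `HC_AV` (stmt-1333), `HC_CM` (stmt-3052) and H2 are NOT proved and do not occur. X2 ∕ X1 stay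
`@[conjecture]` (OURS); `WeilSixfolds` (stmt-2524) appears only as a displayed hypothesis of the HC corollary. KERNEL ONLY:
one-line theorems over existing declarations; no definition, no `sorry`, no named fact; restates nothing.

* `census_row11_kWeil''` — `census_row11_kWeil'` (p703843: `¬ IsOfCMType` already discharged) with the binder
  `hmixed : ∀ k, n_{μ k} ≠ 0 ∧ n_{μ̄ k} ≠ 0` DISCHARGED by `AbelianVariety.eigenMultiplicity_ne_zero_of_cmField_of_add_eq`
  (`CMThetaKWeil.exists_mixed_place`: a CM field acting with multiplicity `≥ 2` has a mixed place — Mumford ∕ Deligne CM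
  criterion against Moonen–Zarhin irreducibility — and the `K`-signature `n_{μ k₁} + n_{μ k₂} = 3` transfers mixedness).
  Remaining member data of ROW 11: `(A, φ)` of Weil type `(3, d)`, `A` simple, L16b's `E`-data, `dim_ℚ End⁰(A) = 2|ι|`, CM type
  `μ` = the `K`-fibre with two places, pair multiplicity `3`, `K`-signature `3`.
* `hodgeConjectureFor_row11_kWeil_of_weilSixfolds'` — the same reduction for the HC corollary keyed by `WeilSixfolds`.
All declarations in the sub-namespace `TableX.WeilLieRows`; typed ≠ proved.
-/

set_option linter.dupNamespace false

noncomputable section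

open scoped TensorProduct
open CategoryTheory
open Literature.AlgebraicGeometry Literature.AlgebraicGeometry.Motives
open Literature.AlgebraicGeometry.Motives.AbelianVariety (IsIsogenous IsSimple)
open Literature.AlgebraicGeometry.Motives.HodgeStructure
open Literature.AlgebraicGeometry.HodgeTheory
open Literature.AlgebraicGeometry.Milne1999
open Literature.AlgebraicGeometry.Deligne1982 (isOfHodgeType_one_one_of_isKaehlerClass_smul)
open Literature.AlgebraicGeometry.VanGeemen1994 (pullbackOne hodgeGroupOne detOnEigenspace hodgeClassSpan)
open Literature.AlgebraicTopology.SingularHomology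
open Literature.Barriers.HodgeConjecture
open Literature.Geometry.Kaehler (HasHardLefschetzProperty)
open Summit.HodgeConjecture.HodgeConjecture.Ring2.ClassTargets
open Summit.HodgeConjecture.HodgeConjecture.Ring2.Motiv (ProdCMCell)
open Summit.HodgeConjecture.HodgeConjecture.Ring2.Atlas (IsQuarticFieldTypeIVFourfold)

namespace Summit.HodgeConjecture.HodgeConjecture.TableX.WeilLieRows

variable (A : AbelianVariety ℂ) (φ : A ⟶ A) (d : ℕ) {h : complexBetti A.X 2}

/-- **ROW 11, EVERY MEMBER — census with `hmixed` (and `¬ IsOfCMType`) DISCHARGED** (see the module docstring). HC NOT proved.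
[cite: MoonenZarhin1999LowDim, (1.9) and (2.3)] [cite: Deligne1982HodgeCycles, I §3 Ex. 3.7]
[cite: Milne1999LefschetzClasses, Thm. 3.2 and Cor. 4.5] -/
theorem census_row11_kWeil'' (hW : IsWeilType A φ 3 d) (hS : IsSimple A)
    (φE φEdag : A ⟶ A) (hgen : ∀ ψ : A ⟶ A, pullbackOne A ψ ∈ Algebra.adjoin ℂ {pullbackOne A φE})
    (hdiag : ⨆ μ : ℂ, Module.End.eigenspace (pullbackOne A φE) μ = ⊤)
    (hQ : IsRationalClass h) (hK : ∃ s : ℝ, 0 < s ∧ IsKaehlerClass A.dim A.X ((s : ℂ) • h))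
    (hRos : ∀ x y : complexBetti A.X 1,
      polarizationPairingOne A.X h (A.dim - 1) (pullbackOne A φE x) y =
        polarizationPairingOne A.X h (A.dim - 1) x (pullbackOne A φEdag y))
    (hφQ : ∀ x y, polarizationPairingOne A.X h (A.dim - 1) (pullbackOne A φ x) (pullbackOne A φ y) =
      (d : ℂ) • polarizationPairingOne A.X h (A.dim - 1) x y)
    {ι : Type} [Fintype ι] [DecidableEq ι]
    (hE : Module.finrank ℚ A.endAlgebra = 2 * Fintype.card ι)
    (μ : ι → ℂ) (hinj : Function.Injective μ) (hdist : ∀ k k', μ k' ≠ starRingEnd ℂ (μ k))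
    (hmult : ∀ k, eigenMultiplicity A φE (μ k) + eigenMultiplicity A φE (starRingEnd ℂ (μ k)) = 3)
    (k₁ k₂ : ι) (hk₁₂ : k₁ ≠ k₂) (hι : ∀ k, k = k₁ ∨ k = k₂)
    (hKW : eigenMultiplicity A φE (μ k₁) + eigenMultiplicity A φE (μ k₂) = 3)
    (hKE : ∀ k, Module.End.eigenspace (((bettiCohomology.map φE.hom.hom.hom 1).hom).baseChange ℂ) (μ k) ≤
      Module.End.eigenspace (((bettiCohomology.map φ.hom.hom.hom 1).hom).baseChange ℂ) (Complex.I * (Real.sqrt d : ℂ)))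
    (hKE' : ∀ k, Module.End.eigenspace (((bettiCohomology.map φE.hom.hom.hom 1).hom).baseChange ℂ) (starRingEnd ℂ (μ k)) ≤
      Module.End.eigenspace (((bettiCohomology.map φ.hom.hom.hom 1).hom).baseChange ℂ) (-(Complex.I * (Real.sqrt d : ℂ)))) :
    (A.dim = 6 ∧ ¬ (IsOfCMType A ∨ ProdCMCell IsQuarticFieldTypeIVFourfold (fun Z ↦ Z.dim = 2) A)) ∧
    (∀ c : complexBetti A.X (2 * 2), IsRationalClass c → IsOfHodgeType A.dim A.X (2 * 2) 2 2 c →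
      c ∈ divisorClassesSpan A.X A.dim 2 ⊔ Submodule.span ℂ {w' : complexBetti A.X (2 * 2) |
        ∃ (C : AbelianVariety ℂ) (g : A.X ⟶ C.X) (w : complexBetti C.X (2 * 2)), C.dim < A.dim ∧
          IsRationalClass w ∧ IsOfHodgeType C.dim C.X (2 * 2) 2 2 w ∧ w' = complexBetti.map g (2 * 2) w}) ∧
    (∀ c : complexBetti A.X (2 * 3), IsRationalClass c → IsOfHodgeType A.dim A.X (2 * 3) 3 3 c →
      c ∈ divisorClassesSpan A.X A.dim 3 ⊔ Submodule.span ℂ {w' : complexBetti A.X (2 * 3) |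
          ∃ (a : complexBetti A.X (2 * 2)) (b : complexBetti A.X (2 * 1)),
            IsRationalClass a ∧ IsOfHodgeType A.dim A.X (2 * 2) 2 2 a ∧ IsRationalClass b ∧
            IsOfHodgeType A.dim A.X (2 * 1) 1 1 b ∧ w' = cupProduct (two_mul_add_two_mul 2 1) a b} ⊔
        Submodule.span ℂ {w' : complexBetti A.X (2 * 3) |
          ∃ (C : AbelianVariety ℂ) (g : A.X ⟶ C.X) (w : complexBetti C.X (2 * 3)), C.dim < A.dim ∧
            IsRationalClass w ∧ IsOfHodgeType C.dim C.X (2 * 3) 3 3 w ∧ w' = complexBetti.map g (2 * 3) w} ⊔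
        Submodule.span ℂ {w' : complexBetti A.X (2 * 3) |
          ∃ (B' : AbelianVariety ℂ) (g : A.X ⟶ B'.X) (d : ℕ) (ψ : B' ⟶ B') (w : complexBetti B'.X (2 * 3)),
            B'.dim = 6 ∧ 0 < d ∧ ψ ≫ ψ = -(d • 𝟙 B') ∧ IsRationalClass w ∧
            IsOfHodgeType B'.dim B'.X (2 * 3) 3 3 w ∧ w ∈ weilClassesOf B' ψ 3 d ∧
            w' = complexBetti.map g (2 * 3) w}) := by
  haveI : HodgeTensorFacts.{0, 0} := hodgeTensorFacts_holds
  have hcard2 : Fintype.card ι = 2 := by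
    have huniv : (Finset.univ : Finset ι) = {k₁, k₂} := by
      ext k
      simp only [Finset.mem_univ, Finset.mem_insert, Finset.mem_singleton, true_iff]
      exact hι k
    rw [← Finset.card_univ, huniv, Finset.card_insert_of_notMem (by rw [Finset.mem_singleton]; exact hk₁₂),
      Finset.card_singleton]
  exact census_row11_kWeil' A φ d hW hS φE φEdag hgen hdiag hQ hK hRos hφQ hE μ hinj hdist hmult
    (AbelianVariety.eigenMultiplicity_ne_zero_of_cmField_of_add_eq A φE hE μ hinj hdist (by norm_num) hmult
      (by rw [hW.dim_eq, hcard2]) k₁ k₂ hι hKW) k₁ k₂ hk₁₂ hι hKW hKE hKE'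

/-- **HC for every ROW-11 member ⟸ the DISPLAYED `WeilSixfolds` (stmt-2524), `hmixed` discharged.** HC NOT proved unconditionally.
[cite: vanGeemen1994HodgeAV, 2.4 and Thm. 6.12] [cite: Milne1999LefschetzClasses, Cor. 4.5] [cite: MoonenZarhin1999LowDim, (2.3)] -/
theorem hodgeConjectureFor_row11_kWeil_of_weilSixfolds'
    (hW₆ : Theses.SevenfoldWeilCensus.WeilSixfolds)
    (hW : IsWeilType A φ 3 d) (hS : IsSimple A) (φE φEdag : A ⟶ A)
    (hgen : ∀ ψ : A ⟶ A, pullbackOne A ψ ∈ Algebra.adjoin ℂ {pullbackOne A φE})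
    (hdiag : ⨆ μ : ℂ, Module.End.eigenspace (pullbackOne A φE) μ = ⊤)
    (hQ : IsRationalClass h) (hK : ∃ s : ℝ, 0 < s ∧ IsKaehlerClass A.dim A.X ((s : ℂ) • h))
    (hRos : ∀ x y : complexBetti A.X 1,
      polarizationPairingOne A.X h (A.dim - 1) (pullbackOne A φE x) y =
        polarizationPairingOne A.X h (A.dim - 1) x (pullbackOne A φEdag y))
    (hφQ : ∀ x y, polarizationPairingOne A.X h (A.dim - 1) (pullbackOne A φ x) (pullbackOne A φ y) =
      (d : ℂ) • polarizationPairingOne A.X h (A.dim - 1) x y)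
    {ι : Type} [Fintype ι] [DecidableEq ι]
    (hE : Module.finrank ℚ A.endAlgebra = 2 * Fintype.card ι)
    (μ : ι → ℂ) (hinj : Function.Injective μ) (hdist : ∀ k k', μ k' ≠ starRingEnd ℂ (μ k))
    (hmult : ∀ k, eigenMultiplicity A φE (μ k) + eigenMultiplicity A φE (starRingEnd ℂ (μ k)) = 3)
    (k₁ k₂ : ι) (hk₁₂ : k₁ ≠ k₂) (hι : ∀ k, k = k₁ ∨ k = k₂)
    (hKW : eigenMultiplicity A φE (μ k₁) + eigenMultiplicity A φE (μ k₂) = 3)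
    (hKE : ∀ k, Module.End.eigenspace (((bettiCohomology.map φE.hom.hom.hom 1).hom).baseChange ℂ) (μ k) ≤
      Module.End.eigenspace (((bettiCohomology.map φ.hom.hom.hom 1).hom).baseChange ℂ) (Complex.I * (Real.sqrt d : ℂ)))
    (hKE' : ∀ k, Module.End.eigenspace (((bettiCohomology.map φE.hom.hom.hom 1).hom).baseChange ℂ) (starRingEnd ℂ (μ k)) ≤
      Module.End.eigenspace (((bettiCohomology.map φ.hom.hom.hom 1).hom).baseChange ℂ) (-(Complex.I * (Real.sqrt d : ℂ)))) :
    HodgeConjectureFor A.dim A.X := by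
  have hcard2 : Fintype.card ι = 2 := by
    have huniv : (Finset.univ : Finset ι) = {k₁, k₂} := by
      ext k
      simp only [Finset.mem_univ, Finset.mem_insert, Finset.mem_singleton, true_iff]
      exact hι k
    rw [← Finset.card_univ, huniv, Finset.card_insert_of_notMem (by rw [Finset.mem_singleton]; exact hk₁₂),
      Finset.card_singleton]
  haveI : HodgeTensorFacts.{0, 0} := hodgeTensorFacts_holds
  exact hodgeConjectureFor_row11_kWeil_of_weilSixfolds A φ d hW₆ hW hS φE φEdag hgen hdiag hQ hK hRos hφQ hE μ hinj hdist hmult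
    (AbelianVariety.eigenMultiplicity_ne_zero_of_cmField_of_add_eq A φE hE μ hinj hdist (by norm_num) hmult
      (by rw [hW.dim_eq, hcard2]) k₁ k₂ hι hKW) k₁ k₂ hk₁₂ hι hKW hKE hKE'

end Summit.HodgeConjecture.HodgeConjecture.TableX.WeilLieRows
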